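import Literature.Topology.FourManifolds.SPC4HandlesLeaves
import Literature.GroupTheory.CombinatorialGroupTheory.NielsenTheorem
import HarnessLib

/-!
# Discharge of Nielsen's theorem `autFreeGroup_eq_closure_nielsen`

Topic `Literature/Topology/FourManifolds`; proofs file next to `BalancedPresentationBasisChange.lean`,
whose named fact `Literature.Topology.FourManifolds.autFreeGroup_eq_closure_nielsen` — *for every
`n`, the automorphism group of the free group `F(x₀, …, x_{n-1})` is generated by the elementary
Nielsen automorphisms `xₖ ↦ xₖ⁻¹` (`nielsenInv k`) and `xₖ ↦ xₖ xₗ`, `k ≠ l` (`nielsenMul k l`)*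
(Nielsen, Math. Ann. 91 (1924); Johnson, *Presentations of Groups* (1997), Ch. 3 §4, Cor. 7;
Lyndon–Schupp, *Combinatorial Group Theory* (1977/2001), Ch. I, Prop. 4.1) — is **proved** here
(`autFreeGroup_eq_closure_nielsen_holds`) from the tree's Nielsen theorem
`Literature.GroupTheory.CombinatorialGroupTheory.nielsenSubgroup_fin_eq_top`
(`Literature/GroupTheory/CombinatorialGroupTheory/NielsenTheorem.lean`, Nielsen's method after
Lyndon–Schupp, Ch. I §2 and Prop. 4.1): the generating automorphisms there (`nielsenAlpha k`,
`nielsenBeta k l`, for a free group on any `ι`) are definitionally `nielsenInv k`, `nielsenMul k l`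
at `ι = Fin n`, and `elementaryNielsen (Fin p)` is definitionally `nielsenGenerators p`
(`SPC4HandlesNielsenReduction.lean`).

Users of the fact (`isAndrewsCurtisEquivalent_mulAut_comp_trivial_iff` here;
`SPC4HandlesNielsenReduction.lean` / `SPC4HandlesLeaves.lean` for Laudenbach–Poénaru's Lemma 2
and extension theorem) are fed `autFreeGroup_eq_closure_nielsen_holds`:
`isAndrewsCurtisEquivalent_mulAut_comp_trivial_iff'` and
`exists_diffeomorph_comp_incl_eq_of_four_leaves` below.

## References

* J. Nielsen, *Die Isomorphismengruppe der freien Gruppen*, Math. Ann. 91 (1924), 169–209.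
  [Nielsen1924]
* R. C. Lyndon, P. E. Schupp, *Combinatorial Group Theory* (1977; Classics in Mathematics 2001),
  Ch. I, Prop. 4.1. [LyndonSchupp2001]
* D. L. Johnson, *Presentations of Groups*, 2nd ed. (1997), Ch. 3 §4, Cor. 7. [Johnson1997]
-/

namespace Literature.Topology.FourManifolds

open Literature.GroupTheory.CombinatorialGroupTheory

universe u

variable {n : ℕ}

/-- The tree's `nielsenInv k` (`BalancedPresentationBasisChange.lean`) is the elementary
automorphism `nielsenAlpha k` of `NielsenMoves.lean` at `ι = Fin n` (same construction:
definitional). [folklore] -/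
theorem nielsenInv_eq_nielsenAlpha (k : Fin n) : nielsenInv k = nielsenAlpha k := rfl

/-- The tree's `nielsenMul k l h` is the elementary automorphism `nielsenBeta k l h` of
`NielsenMoves.lean` at `ι = Fin n` (definitional). [folklore] -/
theorem nielsenMul_eq_nielsenBeta {k l : Fin n} (hkl : k ≠ l) : nielsenMul k l hkl = nielsenBeta k l hkl :=
  rfl

/-- The generating set `nielsenGenerators p` of the named fact (`SPC4HandlesNielsenReduction.lean`,
literally the set inside `autFreeGroup_eq_closure_nielsen`) is the set `elementaryNielsen (Fin p)`
of `NielsenMoves.lean` (definitional). [folklore] -/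
theorem nielsenGenerators_eq_elementaryNielsen (p : ℕ) :
    nielsenGenerators p = elementaryNielsen (Fin p) := rfl

/-- **Nielsen's theorem (discharge of the named fact `autFreeGroup_eq_closure_nielsen`)**: for
every `n`, `Aut F(x₀, …, x_{n-1})` is generated by the `n²` elementary Nielsen automorphisms
`xₖ ↦ xₖ⁻¹` and `xₖ ↦ xₖ xₗ` (`l ≠ k`) — Nielsen (1924); Lyndon–Schupp, Ch. I, Prop. 4.1 (*"if `F`
has finite rank, then `Aut_f(F) = Aut(F)`"*); Johnson (1997), Ch. 3 §4, Cor. 7 — by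
`nielsenSubgroup_fin_eq_top` (Nielsen's method: reduction of the measure
`(Σ‖βxᵢ‖, Σ M(βxᵢ))` by regular Nielsen moves until the basis `(βxᵢ)` is Nielsen reduced, when
`β` is a signed permutation). [cite: LyndonSchupp2001, Ch. I §4, Prop. 4.1]
[cite: Johnson1997, Ch. 3 §4 Cor. 7] [cite: Nielsen1924] -/
theorem autFreeGroup_eq_closure_nielsen_holds : autFreeGroup_eq_closure_nielsen :=
  autFreeGroup_eq_closure_nielsen_iff.2 fun p => by
    rw [nielsenGenerators_eq_elementaryNielsen]
    exact nielsenSubgroup_fin_eq_top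

/-- **Andrews–Curtis triviality is invariant under every change of free basis**, now
unconditionally (`isAndrewsCurtisEquivalent_mulAut_comp_trivial_iff` fed with Nielsen's theorem).
[folklore] -/
theorem isAndrewsCurtisEquivalent_mulAut_comp_trivial_iff' (φ : MulAut (FreeGroup (Fin n)))
    (P : BalancedPresentation n) :
    IsAndrewsCurtisEquivalent (⇑φ ∘ P) (BalancedPresentation.trivial n) ↔
      IsAndrewsCurtisEquivalent P (BalancedPresentation.trivial n) :=
  isAndrewsCurtisEquivalent_mulAut_comp_trivial_iff autFreeGroup_eq_closure_nielsen_holds φ P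

/-- **Laudenbach–Poénaru's extension theorem from its four remaining leaves** (Nielsen's
theorem being discharged): `exists_diffeomorph_comp_incl_eq` follows from Milnor's Thm. 5.4 on a
slab, the `1`-handle uniqueness L1, the realisation REALISE of Laudenbach–Poénaru's `H₁, H₂, H₃`
on the model, and the orientation-preserving case THMAᴹ of Thm. A on the model —
`exists_diffeomorph_comp_incl_eq_of_leaves` (`SPC4HandlesLeaves.lean`) fed with
`autFreeGroup_eq_closure_nielsen_holds`. [cite: LaudenbachPoenaruBSMF1972, §2, Lemma 2 and proof of Thm. A] -/
theorem exists_diffeomorph_comp_incl_eq_of_four_leaves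
    (h54 : Cobordism.Milnor1965_firstCancellation_slab.{u})
    (h₁ : oneHandle_nonempty_diffeomorph.{u})
    (hR : exists_oneHandlebody_realise_laudenbachPoenaruGenerators.{u})
    (hA : exists_oneHandlebody_laudenbachPoenaru_diffeoExtends_of_isOrientationPreserving.{u}) :
    exists_diffeomorph_comp_incl_eq.{u} :=
  exists_diffeomorph_comp_incl_eq_of_leaves h54 h₁ autFreeGroup_eq_closure_nielsen_holds hR hA

end Literature.Topology.FourManifolds
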